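import Mathlib
import HarnessLib
import Summits.HubbardSuperconductivity.HubbardSuperconductivity.Theorems.KLProgrammeKLRegimeTwoPointAssemblyLimitDefs
import Summits.HubbardSuperconductivity.HubbardSuperconductivity.Theorems.KLProgrammeKLRegimeTwoPointAssemblyConservation
import Summits.HubbardSuperconductivity.HubbardSuperconductivity.Theorems.KLProgrammeKLRegimeTwoPointAssemblyGrassmannRepr
import Literature.MathematicalPhysics.QuantumLattice.HubbardFrameNormalisation

/-!
# Child 4 `KLRegimeTwoPointAssembly` of crux K3 (V7 cut), stub `stub_asm_diag`: the representation `twoPointReprCT` IS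
# `reprFree + reprInt` (seat hubbard-kl-r2d-p2)

The pair function `A_K = contr C^K` of the countertermed covariance pairs only `ψ̂⁺_{kσ}` with `ψ̂⁻_{kσ}`
(`A_K(ψ̂⁺_{kσ}, ψ̂⁻_{kσ}) = −βL² ĝ_K(k)`, `hubbardCovarianceCT_plus_minus`), and the two-point kernel of the fully integrated action
`𝒢^K` conserves frequency, momentum and spin (`kernel_fullActionCT_two_eq_zero_of_ne`); so the label sums of `twoPointReprCT` collapse to
the diagonal, where `constPart (∂_{ψ̂⁺_{kσ}} ∂_{ψ̂⁻_{kσ}} 𝒢^K) = −Σ̂(k,σ)/(βL²)` (`Σ̂ = selfEnergy = 𝒱₂(ψ̂⁺, ψ̂⁻)`) and the two field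
coefficients at imaginary time `0` multiply to `(βL²)⁻² e^{ip·(x̄−ȳ)}`.
-/

noncomputable section

namespace Summit.HubbardSuperconductivity.HubbardSuperconductivity.Theorems.TwoPointAssembly

set_option linter.dupNamespace false -- summit = problem name (single-conjunct summit), D-0017

open Finset Literature.MathematicalPhysics.QuantumLattice Literature.Probability.LatticeModels GrassmannAlgebra
open scoped ComplexConjugate

variable {L M : ℕ} [NeZero L]

/-! ## §1 The pair function of `C^K` -/

/-- `A_K = contr C^K` is the free two-point table of the frame: `A_K(X,Y) = ⟨ψ_X ψ_Y⟩^K = −C^K(X,Y)`. -/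
theorem contr_hubbardCovarianceCT (β μ : ℝ) (K : TrigPolyC4v) (X Y : HubbardFieldIdx L M) :
    contr ℂ (hubbardCovarianceCT L M β μ 0 K) X Y = -hubbardCovarianceCT L M β μ 0 K X Y := by
  rw [contr_apply, ← gaussExpect_gen_mul_gen, gaussExpect_hubbardCovarianceCT_gen_mul_gen, hubbardCovarianceCT,
    Matrix.of_apply, neg_neg]

omit [NeZero L] in
/-- The propagator of the frame in closed form: `1/(−iω + e) = (iω + e)/(ω² + e²)`. -/
theorem propCT_eq_div_nambuDenCT {β : ℝ} (hβ : β ≠ 0) (μ : ℝ) (K : TrigPolyC4v) (k : FreqMomentum L M) :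
    propCT L M β μ K k =
      (Complex.I * matsubaraFreq β M k.1 + nambuXiCT L μ K k.2) / (nambuDenCT L M β μ 0 K k : ℂ) := by
  rw [propCT, ← nambuPropagatorCT_zero_seed L M hβ μ K k]
  simp [nambuPropagatorCT]

/-- `A_K(ψ̂⁺_{kσ}, ψ̂⁻_{kσ}) = −βL² ĝ_K(k)`. -/
theorem contr_plus_minus {β : ℝ} (hβ : β ≠ 0) (μ : ℝ) (K : TrigPolyC4v) (k : FreqMomentum L M) (σ : Fin 2) :
    contr ℂ (hubbardCovarianceCT L M β μ 0 K) ((k, σ), 0) ((k, σ), 1) =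
      -(((β * (L : ℝ) ^ 2 : ℝ) : ℂ) * propCT L M β μ K k) := by
  rw [contr_hubbardCovarianceCT, hubbardCovarianceCT_plus_minus β μ 0 K k σ, propCT_eq_div_nambuDenCT hβ]

/-- `A_K(ψ̂⁻_{kσ}, ψ̂⁺_{kσ}) = +βL² ĝ_K(k)`. -/
theorem contr_minus_plus {β : ℝ} (hβ : β ≠ 0) (μ : ℝ) (K : TrigPolyC4v) (k : FreqMomentum L M) (σ : Fin 2) :
    contr ℂ (hubbardCovarianceCT L M β μ 0 K) ((k, σ), 1) ((k, σ), 0) =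
      ((β * (L : ℝ) ^ 2 : ℝ) : ℂ) * propCT L M β μ K k := by
  rw [contr_swap, contr_plus_minus hβ, neg_neg]

/-- `A_K(ψ̂⁺_{kσ}, Y) = 0` unless `Y = ψ̂⁻_{kσ}`. -/
theorem contr_plus_eq_zero (β μ : ℝ) (K : TrigPolyC4v) (k : FreqMomentum L M) (σ : Fin 2) {Y : HubbardFieldIdx L M}
    (hY : Y ≠ ((k, σ), 1)) : contr ℂ (hubbardCovarianceCT L M β μ 0 K) ((k, σ), 0) Y = 0 := by
  rw [contr_hubbardCovarianceCT, neg_eq_zero]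
  by_cases h1 : ((k, σ) : FreqMomentum L M × Fin 2) = Y.1
  · have h2 : (0 : Fin 2) = Y.2 := by
      by_contra h2
      apply hY
      obtain ⟨Y1, Y2⟩ := Y
      simp only at h1 h2
      subst h1
      fin_cases Y2 <;> simp_all
    exact hubbardCovarianceCT_eq_zero_of_charge_eq β μ K h2
  · exact hubbardCovarianceCT_eq_zero_of_fst_ne β μ K h1

/-- `A_K(ψ̂⁻_{kσ}, Z) = 0` unless `Z = ψ̂⁺_{kσ}`. -/
theorem contr_minus_eq_zero (β μ : ℝ) (K : TrigPolyC4v) (k : FreqMomentum L M) (σ : Fin 2) {Z : HubbardFieldIdx L M}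
    (hZ : Z ≠ ((k, σ), 0)) : contr ℂ (hubbardCovarianceCT L M β μ 0 K) ((k, σ), 1) Z = 0 := by
  rw [contr_hubbardCovarianceCT, neg_eq_zero]
  by_cases h1 : ((k, σ) : FreqMomentum L M × Fin 2) = Z.1
  · have h2 : (1 : Fin 2) = Z.2 := by
      by_contra h2
      apply hZ
      obtain ⟨Z1, Z2⟩ := Z
      simp only at h1 h2
      subst h1
      fin_cases Z2 <;> simp_all
    exact hubbardCovarianceCT_eq_zero_of_charge_eq β μ K h2
  · exact hubbardCovarianceCT_eq_zero_of_fst_ne β μ K h1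

/-! ## §2 The two-point coefficient of `𝒢^K` -/

/-- Off the diagonal: `constPart (∂_{ψ̂⁺_q} ∂_{ψ̂⁻_p} 𝒢^K) = 0` for `p ≠ q` (conservation). -/
theorem constPart_dd_fullActionCT_eq_zero (β U μ : ℝ) (K : TrigPolyC4v) {p q : FreqMomentum L M × Fin 2} (hpq : p ≠ q) :
    constPart ℂ (grassmannDeriv ℂ ((q, 0) : HubbardFieldIdx L M) (grassmannDeriv ℂ ((p, 1) : HubbardFieldIdx L M)
      (fullActionCT L M β U μ K))) = 0 := by
  have h := (kernel_fullActionCT_two_eq_zero_of_ne β U μ K hpq).1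
  rw [kernel_def, ← grassmannDeriv_grassmannDeriv_eq_iterDeriv] at h
  have h2 : ((Nat.factorial 2 : ℚ)⁻¹ • (1 : ℂ)) ≠ 0 := by norm_num
  exact (mul_eq_zero.1 h).resolve_left h2

/-- On the diagonal: `constPart (∂_{ψ̂⁺_{kσ}} ∂_{ψ̂⁻_{kσ}} 𝒢^K) = −Σ̂(k,σ)/(βL²)`. -/
theorem constPart_dd_fullActionCT_eq {β : ℝ} (hβ : β ≠ 0) (U μ : ℝ) (K : TrigPolyC4v) (k : FreqMomentum L M) (σ : Fin 2) :
    constPart ℂ (grassmannDeriv ℂ (((k, σ), 0) : HubbardFieldIdx L M) (grassmannDeriv ℂ (((k, σ), 1) : HubbardFieldIdx L M)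
      (fullActionCT L M β U μ K))) =
      -(selfEnergy L M β (fullActionCT L M β U μ K) k σ / ((β * (L : ℝ) ^ 2 : ℝ) : ℂ)) := by
  have hβL : ((β * (L : ℝ) ^ 2 : ℝ) : ℂ) ≠ 0 := by
    have hL : (L : ℝ) ≠ 0 := by exact_mod_cast NeZero.ne L
    exact_mod_cast mul_ne_zero hβ (pow_ne_zero 2 hL)
  rw [selfEnergy, vertexFn_def, kernel_def, ← grassmannDeriv_grassmannDeriv_eq_iterDeriv,
    grassmannDeriv_grassmannDeriv_comm ℂ ((k, σ), 1) ((k, σ), 0), map_neg]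
  simp only [Nat.factorial_two, Nat.cast_ofNat]
  rw [show ((2⁻¹ : ℚ) • (1 : ℂ)) = (2 : ℂ)⁻¹ by norm_num]
  field_simp
  push_cast
  ring

/-! ## §3 The field coefficients at imaginary time `0` -/

omit [NeZero L] in
/-- `a_k(x̄) b_k(ȳ) = (βL²)⁻² e^{ip·(x̄−ȳ)}`. -/
theorem fieldCoeff_mul_fieldCoeff (β : ℝ) (k : FreqMomentum L M) (xe ye : TorusSite 2 L) :
    fieldCoeff L M β 0 k xe * fieldCoeff L M β 1 k ye =
      sitePhase L k.2 xe ye / (((β * (L : ℝ) ^ 2 : ℝ) : ℂ) ^ 2) := by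
  simp only [fieldCoeff, vertexPlaneWave, vertexPhase, chargeSign, sitePhase, ← Complex.exp_conj, map_mul, map_neg,
    Complex.conj_ofReal, Complex.conj_I, Fin.isValue, ↓reduceIte, one_ne_zero, mul_zero, zero_add]
  rw [show ∀ a b c d : ℂ, a * b * (c * d) = (a * c) * (b * d) from fun a b c d => by ring, ← Complex.exp_add]
  conv_rhs => rw [div_eq_mul_inv, mul_comm]
  congr 1
  · push_cast; ring
  · congr 1
    push_cast
    simp only [mul_sub, Fin.sum_univ_two]
    ring

/-! ## §4 The stub -/

/-- **`stub_asm_diag`** (registered signature of the V7-cut skeleton): the representation splits into its free and interacting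
DIAGONAL momentum sums. -/
theorem stub_asm_diag : ∀ (L M : ℕ) [NeZero L] [NeZero M] (β : ℝ), 0 < β → ∀ (U μ : ℝ) (K : TrigPolyC4v) (σ σ' : Fin 2)
    (xe ye : TorusSite 2 L),
    twoPointReprCT L M β U μ K σ σ' xe ye = reprFree L M β μ K σ σ' xe ye + reprInt L M β U μ K σ σ' xe ye := by
  intro L M _ _ β hβ U μ K σ σ' xe ye
  have hβ0 : β ≠ 0 := hβ.ne'
  have hβL : ((β * (L : ℝ) ^ 2 : ℝ) : ℂ) ≠ 0 := by
    have hL : (L : ℝ) ≠ 0 := by exact_mod_cast NeZero.ne L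
    exact_mod_cast mul_ne_zero hβ0 (pow_ne_zero 2 hL)
  -- collapse the inner label sums `Y, Z`
  have hinner : ∀ k k' : FreqMomentum L M,
      ∑ Y : HubbardFieldIdx L M, ∑ Z : HubbardFieldIdx L M,
          contr ℂ (hubbardCovarianceCT L M β μ 0 K) (((k, σ), 0) : HubbardFieldIdx L M) Y *
            contr ℂ (hubbardCovarianceCT L M β μ 0 K) (((k', σ'), 1) : HubbardFieldIdx L M) Z *
              constPart ℂ (grassmannDeriv ℂ Z (grassmannDeriv ℂ Y (fullActionCT L M β U μ K))) =
        contr ℂ (hubbardCovarianceCT L M β μ 0 K) ((k, σ), 0) ((k, σ), 1) *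
          contr ℂ (hubbardCovarianceCT L M β μ 0 K) ((k', σ'), 1) ((k', σ'), 0) *
            constPart ℂ (grassmannDeriv ℂ (((k', σ'), 0) : HubbardFieldIdx L M)
              (grassmannDeriv ℂ (((k, σ), 1) : HubbardFieldIdx L M) (fullActionCT L M β U μ K))) := by
    intro k k'
    rw [Finset.sum_eq_single (((k, σ), 1) : HubbardFieldIdx L M)]
    · rw [Finset.sum_eq_single (((k', σ'), 0) : HubbardFieldIdx L M)]
      · intro Z _ hZ; rw [contr_minus_eq_zero β μ K k' σ' hZ, mul_zero, zero_mul]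
      · intro h; exact absurd (Finset.mem_univ _) h
    · intro Y _ hY
      exact Finset.sum_eq_zero fun Z _ => by rw [contr_plus_eq_zero β μ K k σ hY, zero_mul, zero_mul]
    · intro h; exact absurd (Finset.mem_univ _) h
  -- the `k'` sum collapses to `k' = k` (and needs `σ' = σ`)
  by_cases hσ : σ = σ'
  · subst hσ
    rw [twoPointReprCT, reprFree, reprInt, if_pos rfl, if_pos rfl]
    simp only [hinner]
    have hk : ∀ k : FreqMomentum L M,
        ∑ k' : FreqMomentum L M, fieldCoeff L M β 0 k xe * fieldCoeff L M β 1 k' ye *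
          (contr ℂ (hubbardCovarianceCT L M β μ 0 K) (((k, σ), 0) : HubbardFieldIdx L M) ((k', σ), 1) +
            contr ℂ (hubbardCovarianceCT L M β μ 0 K) ((k, σ), 0) ((k, σ), 1) *
              contr ℂ (hubbardCovarianceCT L M β μ 0 K) ((k', σ), 1) ((k', σ), 0) *
                constPart ℂ (grassmannDeriv ℂ (((k', σ), 0) : HubbardFieldIdx L M)
                  (grassmannDeriv ℂ (((k, σ), 1) : HubbardFieldIdx L M) (fullActionCT L M β U μ K)))) =
        sitePhase L k.2 xe ye / (((β * (L : ℝ) ^ 2 : ℝ) : ℂ) ^ 2) *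
          (-(((β * (L : ℝ) ^ 2 : ℝ) : ℂ) * propCT L M β μ K k) +
            (-(((β * (L : ℝ) ^ 2 : ℝ) : ℂ) * propCT L M β μ K k)) * (((β * (L : ℝ) ^ 2 : ℝ) : ℂ) * propCT L M β μ K k) *
              -(selfEnergy L M β (fullActionCT L M β U μ K) k σ / ((β * (L : ℝ) ^ 2 : ℝ) : ℂ))) := by
      intro k
      rw [Finset.sum_eq_single k]
      · rw [fieldCoeff_mul_fieldCoeff, contr_plus_minus hβ0, contr_minus_plus hβ0, constPart_dd_fullActionCT_eq hβ0]
      · intro k' _ hk'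
        have hne : ((k, σ) : FreqMomentum L M × Fin 2) ≠ (k', σ) := fun h => hk' (Prod.mk.inj h).1.symm
        rw [contr_plus_eq_zero β μ K k σ (Y := ((k', σ), 1)) (fun h => hne (by simpa using (Prod.mk.inj h).1.symm)),
          constPart_dd_fullActionCT_eq_zero β U μ K hne]
        ring
      · intro h; exact absurd (Finset.mem_univ _) h
    simp only [hk]
    rw [neg_div, div_eq_mul_inv (∑ k, sitePhase L k.2 xe ye * propCT L M β μ K k),
      div_eq_mul_inv (∑ k, sitePhase L k.2 xe ye * propCT L M β μ K k ^ 2 * selfEnergy L M β (fullActionCT L M β U μ K) k σ),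
      Finset.sum_mul, Finset.sum_mul, ← Finset.sum_neg_distrib, ← Finset.sum_add_distrib]
    refine Finset.sum_congr rfl fun k _ => ?_
    field_simp
  · rw [twoPointReprCT, reprFree_of_ne L M β μ K hσ, reprInt_of_ne L M β U μ K hσ, add_zero]
    simp only [hinner]
    refine Finset.sum_eq_zero fun k _ => Finset.sum_eq_zero fun k' _ => ?_
    have hne : ((k, σ) : FreqMomentum L M × Fin 2) ≠ (k', σ') := fun h => hσ (Prod.mk.inj h).2
    rw [contr_plus_eq_zero β μ K k σ (Y := ((k', σ'), 1)) (fun h => hne (by simpa using (Prod.mk.inj h).1.symm)),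
      constPart_dd_fullActionCT_eq_zero β U μ K hne]
    ring

end Summit.HubbardSuperconductivity.HubbardSuperconductivity.Theorems.TwoPointAssembly

end
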